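import Mathlib.Probability.ProbabilityMassFunction.Constructions
import Literature.Computability.Complexity.TimeBounds
import Literature.Computability.Complexity.BoolEncodings
import Literature.Computability.Complexity.Classes
import Literature.Computability.Complexity.Nondeterministic
import Literature.Computability.Complexity.Reductions
import Literature.Computability.Complexity.Randomized
import Literature.Computability.Complexity.ProbabilisticClasses
import HarnessLib

-- provenance: harness21/H21/H21/Prelude/CplxMeta/RandReductions.lean @ c423f1e (interim HEAD d8f2665); M5 mechanical rewrite
/-!
# Complexity meta: randomized polynomial-time many-one reductions

Trunk `CplxMeta`, concept C3 (`RandReductions`; support for the notion `mcsp_language`, e.g.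
"`MCSP*` is NP-hard under randomized reductions", and for Hirahara's NP-hardness results for
meta-complexity problems).

A *randomized* polynomial-time many-one reduction from `L₁` to `L₂` is a probabilistic
polynomial-time algorithm `A : RandAlg (List Bool) (List Bool)` (file
`H21/Prelude/CplxCore/Randomized.lean`) whose output `y = A(x; r)` satisfies
`y ∈ L₂ ↔ x ∈ L₁` with probability at least `2/3` over the coins (two-sided, `BPP`-type), resp.
with one-sided error (`RP`-type: probability `≥ 1/2` of landing in `L₂` when `x ∈ L₁`,
probability `0` when `x ∉ L₁`).

* `PolyTimeRandReducible L₁ L₂` — two-sided randomized Karp reducibility;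
* `PolyTimeRPReducible L₁ L₂` — one-sided randomized Karp reducibility;
* `IsRandHard C L`, `IsRandNPHard L`, `IsRandComplete C L` — hardness/completeness under
  randomized reductions.

API: `PolyTimeKarpReducible.polyTimeRandReducible`, `PolyTimeRPReducible.polyTimeRandReducible`,
`polyTimeRandReducible_refl`, `IsHard.isRandHard`, `mem_BPP_of_polyTimeRandReducible`,
`NP_subset_BPP_of_isRandNPHard_of_mem_BPP`.

Mathlib has only the untimed, deterministic `ManyOneReducible` (`Mathlib/Computability/Reduce.lean`)
and no randomized algorithms or reductions (searched: `Reducible`, `randomi`, `BPP`, `RP`);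
we build on H21's `RandAlg`, `RandAlg.IsPolyTime`, `RandAlg.pr`, `PolyTimeKarpReducible`,
`IsHard`, `NP`, `BPP`.

## Design notes

* Everything lives over `List Bool` with the identity encoder (`A.IsPolyTime id id`,
  `A.pr id x _`), like `PolyTimeKarpReducible`.
* In `PolyTimeRandReducible` the event is `{y | y ∈ L₂ ↔ x ∈ L₁}` with `↔` inside `setOf`
  ("the answer to the query `y` is the correct verdict"), the idiom of `bp`.
* In `PolyTimeRPReducible` the "no false positives" clause is `A.pr id x {y | y ∈ L₂} = 0`,
  i.e. it concerns only coin strings of the prescribed length `coinLen |x|` (the ones the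
  output distribution samples). We deliberately do **not** write `∀ r, A.run x r ∉ L₂`, which
  would quantify over coin strings of every length and is stronger than the papers' notion.
* The constants `2/3` and `1/2` are the textbook ones (robust by amplification when `L₂` admits
  it, e.g. via majority vote for `BPP`-closure; not stated here).
* `PolyTimeRPReducible.polyTimeRandReducible` (one-sided ⇒ two-sided) carries an explicit
  OR-closure hypothesis on `L₂`: amplifying a *many-one* reduction from success `1/2` to `2/3`
  needs to combine two queries into one, which is not possible for an arbitrary target.
* Transitivity of randomized reductions is not stated (it needs amplification, which is not
  available for many-one reductions to an arbitrary `L₂`); `mem_BPP_of_polyTimeRandReducible`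
  is the closure property the target statements consume.
* **Erratum (coin-length leak).** `RandAlg.IsPolyTime` only *bounds* the coin budget
  `A.coinLen : ℕ → ℕ` (an arbitrary, possibly non-computable function) while `A.pr` feeds `A.run`
  coins of length *exactly* `coinLen |x|`; so `PolyTimeRandReducible` and `PolyTimeRPReducible`
  admit the "reduction" `run x r := ⟨x, r⟩`, `coinLen n := [n ∈ S]`, which reduces
  `{x | |x| ∈ S}` to the odd-length strings (a language in `P`) for **every** `S ⊆ ℕ`
  (`polyTimeRandReducible_lengthSet`, `RandReductionsLeak.lean`). Consequently the named fact
  `mem_BPP_of_polyTimeRandReducible` below is MIS-STATED (false in the standard model: it would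
  put `2^ℵ₀` languages into the countable class `BPP`,
  `lengthSet_mem_BPP_of_mem_BPP_of_polyTimeRandReducible`, ibid.) and is kept only for its
  importers; Arora–Barak's PTMs read exactly `p(|x|)` coins for a polynomial `p` (Def. 7.1/7.3),
  and the corrected notion and fact — `PolyTimeRandReducible'` (exact-polynomial budget, the
  language case of `PromiseRandReducible`) and `mem_BPP_of_polyTimeRandReducible'`, proved — are in
  `RandReductionsBPPProofs.lean`.

## References

* S. Arora, B. Barak, *Computational Complexity: A Modern Approach*, CUP 2009, §7.6
  (randomized reductions, Def. 7.18 area: `BP·NP`-hardness), Def. 2.7 (Karp reductions).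
* L. Valiant, V. Vazirani, *NP is as easy as detecting unique solutions*, TCS 47 (1986)
  (one-sided randomized reductions).
* S. Hirahara, *NP-hardness of learning programs and partial MCSP*, FOCS 2022, §2
  (randomized polynomial-time many-one reductions, one- and two-sided).
* L. Adleman, K. Manders, *Reducibility, randomness, and intractability*, STOC 1977.
-/

namespace Literature.Computability.MetaComplexity

open _root_.Computability Complexity Complexity.Nondeterministic

open scoped Complexity.Notation

/-! ### Randomized reducibility -/

/-- `PolyTimeRandReducible L₁ L₂`: `L₁` reduces to `L₂` by a randomized polynomial-time
many-one reduction with two-sided error — there is a probabilistic polynomial-time algorithm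
`A : {0,1}* × coins → {0,1}*` such that for every input `x`,
`Pr_r[(A(x; r) ∈ L₂ ↔ x ∈ L₁)] ≥ 2/3`.
[Arora–Barak 2009, §7.6 (randomized reductions); Hirahara FOCS 2022, §2] [cite: AroraBarak2009, §7.6 (randomized reductions] -/
def PolyTimeRandReducible (L₁ L₂ : Language Bool) : Prop :=
  ∃ A : RandAlg (List Bool) (List Bool),
    A.IsPolyTime id (id : List Bool → List Bool) ∧
      ∀ x : List Bool, 2 / 3 ≤ A.pr id x {y : List Bool | y ∈ L₂ ↔ x ∈ L₁}

/-- `PolyTimeRPReducible L₁ L₂`: `L₁` reduces to `L₂` by a randomized polynomial-time many-one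
reduction with one-sided error (`RP`-type) — there is a probabilistic polynomial-time algorithm
`A` such that `x ∈ L₁ → Pr_r[A(x; r) ∈ L₂] ≥ 1/2` and `x ∉ L₁ → Pr_r[A(x; r) ∈ L₂] = 0`
(the probability is over coin strings of the prescribed length `coinLen |x|`).
[Valiant–Vazirani 1986; Arora–Barak 2009, §7.6 and Def. 7.6 (RP); Hirahara FOCS 2022, §2] [cite: ValiantVazirani1986] -/
def PolyTimeRPReducible (L₁ L₂ : Language Bool) : Prop :=
  ∃ A : RandAlg (List Bool) (List Bool),
    A.IsPolyTime id (id : List Bool → List Bool) ∧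
      (∀ x ∈ L₁, (1 : ℝ) / 2 ≤ A.pr id x {y : List Bool | y ∈ L₂}) ∧
        ∀ x ∉ L₁, A.pr id x {y : List Bool | y ∈ L₂} = 0

/-! ### Hardness and completeness under randomized reductions -/

/-- `IsRandHard C L`: `L` is `C`-hard under randomized (two-sided error) polynomial-time
many-one reductions, i.e. every `L' ∈ C` satisfies `PolyTimeRandReducible L' L`.
[Arora–Barak 2009, §7.6; Hirahara FOCS 2022, §1–2] [cite: AroraBarak2009, §7.6] -/
def IsRandHard (C : Set (Language Bool)) (L : Language Bool) : Prop :=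
  ∀ L' ∈ C, PolyTimeRandReducible L' L

/-- `IsRandNPHard L`: `L` is NP-hard under randomized polynomial-time many-one reductions.
[Arora–Barak 2009, §7.6; Hirahara FOCS 2022, Thm. 1.1 area] [cite: AroraBarak2009, §7.6] -/
abbrev IsRandNPHard (L : Language Bool) : Prop :=
  IsRandHard NP L

/-- `IsRandComplete C L`: `L ∈ C` and `L` is `C`-hard under randomized polynomial-time
many-one reductions. [Arora–Barak 2009, §7.6 and Def. 2.7] [cite: AroraBarak2009, §7.6 and Def. 2.7] -/
def IsRandComplete (C : Set (Language Bool)) (L : Language Bool) : Prop :=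
  L ∈ C ∧ IsRandHard C L

/-! ### API -/

/-- A deterministic Karp reduction is a randomized reduction (use `RandAlg.ofDet f`, which is
correct with probability `1`). The hypothesis `hdet` is the known result
`RandAlg.IsPolyTime.ofDet` (a polynomial-time string function run coin-free is PPT; it needs
machine composition and is vendored upstream as a named fact) at string functions
`{0,1}* → {0,1}*`. [Arora–Barak 2009, §7.1 (P ⊆ BPP) and §7.6] [cite: AroraBarak2009, §7.6] -/
theorem _root_.Literature.Computability.Complexity.PolyTimeKarpReducible.polyTimeRandReducible
    (hdet : ∀ f : List Bool → List Bool, PolyTimeComputable id id f →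
      (RandAlg.ofDet f).IsPolyTime id (id : List Bool → List Bool))
    {L₁ L₂ : Language Bool} (h : L₁ ≤ₚ L₂) : PolyTimeRandReducible L₁ L₂ := by
  classical
  obtain ⟨f, hf, hL⟩ := h
  refine ⟨RandAlg.ofDet f, hdet f hf, fun x => ?_⟩
  have hx : f x ∈ {y : List Bool | y ∈ L₂ ↔ x ∈ L₁} := (hL x).symm
  rw [RandAlg.pr_ofDet, if_pos hx]
  norm_num

/-- A one-sided randomized reduction to a *disjunctively self-reducible* target is a two-sided
one. With success probability only `≥ 1/2` on `x ∈ L₁`, the one-sided reduction does not by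
itself meet the `2/3` threshold, and a many-one reduction cannot test which of several runs
landed in `L₂`; the standard amplification runs it twice with fresh coins and combines the two
queries with a polynomial-time OR-combiner `g` for `L₂`
(`g ⟨y₁, y₂⟩ ∈ L₂ ↔ y₁ ∈ L₂ ∨ y₂ ∈ L₂`, available e.g. for `SAT` and for the paddable
meta-complexity problems this file supports), giving error `≤ 1/4` on `x ∈ L₁` and `0` on
`x ∉ L₁`. The hypothesis `hor` is exactly this OR-closure; without it the implication is not
known for arbitrary `L₂`.
[Arora–Barak 2009, §7.6 and §7.4.1 (error reduction); Valiant–Vazirani 1986, §1 (remark on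
amplification); Hirahara FOCS 2022, §2] [cite: AroraBarak2009, §7.6 and §7.4.1 (error reduction] -/
def PolyTimeRPReducible.polyTimeRandReducible : Prop :=
  ∀ {L₁ L₂ : Language Bool}, PolyTimeRPReducible L₁ L₂ →
    (∃ g : List Bool → List Bool, g ∈ FP ∧
      ∀ y₁ y₂ : List Bool, g (boolPair y₁ y₂) ∈ L₂ ↔ (y₁ ∈ L₂ ∨ y₂ ∈ L₂)) →
    PolyTimeRandReducible L₁ L₂

/-- Randomized reducibility is reflexive (the identity is a deterministic Karp reduction;
hypothesis `hdet` as in `PolyTimeKarpReducible.polyTimeRandReducible`).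
[Arora–Barak 2009, §7.6, Thm. 2.8] [cite: AroraBarak2009, §7.6  Thm. 2.8] -/
theorem polyTimeRandReducible_refl
    (hdet : ∀ f : List Bool → List Bool, PolyTimeComputable id id f →
      (RandAlg.ofDet f).IsPolyTime id (id : List Bool → List Bool))
    (L : Language Bool) : PolyTimeRandReducible L L :=
  (PolyTimeKarpReducible.refl L).polyTimeRandReducible hdet

/-- Hardness under Karp reductions implies hardness under randomized reductions
(hypothesis `hdet` as in `PolyTimeKarpReducible.polyTimeRandReducible`).
[Arora–Barak 2009, §7.6] [cite: AroraBarak2009, §7.6] -/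
theorem _root_.Literature.Computability.Complexity.IsHard.isRandHard
    (hdet : ∀ f : List Bool → List Bool, PolyTimeComputable id id f →
      (RandAlg.ofDet f).IsPolyTime id (id : List Bool → List Bool))
    {C : Set (Language Bool)} {L : Language Bool} (h : IsHard C L) : IsRandHard C L :=
  fun L' hL' => (h L' hL').polyTimeRandReducible hdet

/-- Completeness under Karp reductions implies completeness under randomized reductions
(hypothesis `hdet` as in `PolyTimeKarpReducible.polyTimeRandReducible`).
[Arora–Barak 2009, §7.6] [cite: AroraBarak2009, §7.6] -/
theorem _root_.Literature.Computability.Complexity.IsComplete.isRandComplete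
    (hdet : ∀ f : List Bool → List Bool, PolyTimeComputable id id f →
      (RandAlg.ofDet f).IsPolyTime id (id : List Bool → List Bool))
    {C : Set (Language Bool)} {L : Language Bool} (h : IsComplete C L) : IsRandComplete C L :=
  ⟨h.mem, h.isHard.isRandHard hdet⟩

/-- A randomly complete language is randomly hard. [Arora–Barak 2009, §7.6] [cite: AroraBarak2009, §7.6] -/
theorem IsRandComplete.isRandHard {C : Set (Language Bool)} {L : Language Bool}
    (h : IsRandComplete C L) : IsRandHard C L :=
  h.2

/-- A randomly complete language belongs to its class. [Arora–Barak 2009, §7.6] [cite: AroraBarak2009, §7.6] -/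
theorem IsRandComplete.mem {C : Set (Language Bool)} {L : Language Bool}
    (h : IsRandComplete C L) : L ∈ C :=
  h.1

/-- `BPP` is closed downwards under randomized reductions: if `L₁` randomly reduces to `L₂`
and `L₂ ∈ BPP` then `L₁ ∈ BPP` (amplify the `BPP` algorithm for `L₂` to error `≤ 1/10`, run
it on the query; total error `≤ 1/3 + 1/10 < 1/2`, then amplify by majority vote).

**MIS-STATED — do not try to discharge.** As vendored, the hypothesis `PolyTimeRandReducible`
only *bounds* the (arbitrary, possibly non-computable) coin budget and thereby leaks the bit
`[|x| ∈ S]` (module docstring, "Erratum"): this `Prop` would put `{x | |x| ∈ S}` into `BPP` for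
every `S ⊆ ℕ` (`lengthSet_mem_BPP_of_mem_BPP_of_polyTimeRandReducible`, `RandReductionsLeak.lean`),
so it is false in the standard model, whereas the source's statement concerns PTMs reading
exactly `p(|x|)` coins. The corrected statement is `mem_BPP_of_polyTimeRandReducible'`
(`RandReductionsBPPProofs.lean`, with the normal-form reducibility `PolyTimeRandReducible'`),
discharged there as `mem_BPP_of_polyTimeRandReducible'_holds`. This `def` is kept unchanged
for its importers.
[Arora–Barak 2009, §7.6 (if `L ≤ᵣ L'` and `L' ∈ BPP` then `L ∈ BPP`) and Thm. 7.10
(error reduction)] [cite: AroraBarak2009, §7.6 (if  L ≤ᵣ L'  and  L' ∈ BPP  then] -/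
def mem_BPP_of_polyTimeRandReducible : Prop :=
  ∀ {L₁ L₂ : Language Bool}, PolyTimeRandReducible L₁ L₂ → L₂ ∈ BPP → L₁ ∈ BPP

/-- If some language that is NP-hard under randomized reductions lies in `BPP`, then
`NP ⊆ BPP` (given the downward closure of `BPP` under randomized reductions, hypothesis
`hBPP` = the named fact `mem_BPP_of_polyTimeRandReducible`). **Vacuous as stated**: the
hypothesis `hBPP` is the mis-stated fact above (coin-length leak); the meaningful forms are
`NP_subset_BPP_of_forall_polyTimeRandReducible'` and `subset_BPP_of_isHard_promise_of_mem_BPP`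
(`RandReductionsBPPProofs.lean`), for reductions with an exact-polynomial coin budget.
[Arora–Barak 2009, §7.6 (Def. 7.18 area and the remark following it)] [cite: AroraBarak2009, §7.6 (Def. 7.18 area and the remark foll] -/
theorem NP_subset_BPP_of_isRandNPHard_of_mem_BPP (hBPP : mem_BPP_of_polyTimeRandReducible)
    {L : Language Bool} (h : IsRandNPHard L) (hL : L ∈ BPP) : NP ⊆ BPP :=
  fun L' hL' => hBPP (h L' hL') hL

end Literature.Computability.MetaComplexity
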